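import Summits.BirchSwinnertonDyer.BirchSwinnertonDyer.Theorems.SignedBaseChangeK2RAssembly
import Literature.NumberTheory.EllipticCurves.YanZhu2026.GreenbergMainTheoremsAnyRoot
import Summits.BirchSwinnertonDyer.BirchSwinnertonDyer.Theorems.SignedBaseChangeCanonicalGeneratorPair
import Literature.NumberTheory.EllipticCurves.Kobayashi2003.SignedPAdicLFunctionExistenceProofs
import Literature.NumberTheory.EllipticCurves.HidaFamilyMembersProofs
import HarnessLib

/-!
# The two by-name inputs of K2R⁗ are NOT vacuous: each commits to «Katz's two-variable measure is non-zero»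
# (degenerate-instance audit of the SBC descent crux; seat bsd-wall-sbc-p2 g3, route author's ask)

Route-independent `Theorems` file of the cell `bsd-wall` (crux K2R‴ = stmt-BirchSwinnertonDyer-20213
`Theses.SignedBaseChange.SignedLowerDescentFromCommonFrame`; its proved form K2R⁗ =
`SignedBaseChangeK2RAssembly.signedLowerDescent_of_prop422_of_package`, p533062). K2R⁗ rests on two inputs it takes BY
NAME: (i) the refereed `μ = 0` fact `BurungaleCastellaSkinner2025.prop422_greenbergAnyRoot_hasUnitContent_minus`
(BCS25 Prop. 4.2.2, `L_p^Gr` half, GUARDED v2: frames with `Ω ≠ 0`, `δ² = ±D_K`), (ii) the claim-tagged PREPRINT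
binder `BurungaleSkinnerTianWan2024.props118_27_519_exists_signedTwoVariablePackage_supersingular_PRE` (BSTW Props.
1.18 / 2.7 / 5.19). Both are `∀`-statements over Katz/Greenberg FRAMES, and the frames are pure interpolation
predicates: the v1 form of (i), WITHOUT `Ω ≠ 0`, was contradicted on every instance by the degenerate frame
`(Ω, LK, G) = (0, 0, 0)` (`prop422_grHalf_hasUnitContent_minus.false_of_instance`, tree). The route author
(bsd-wall-ss g5, cell STATUS 2026-08-27T13:35:00Z (3)) asked for the same audit of the two inputs K2R⁗ actually uses —
"try an `LK` with vanishing values / `G = 0` over a frame with `Ω ≠ 0` … if nothing bites, land the non-vacuity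
witness lemmas like sbc-p1's ZeroFrame (p523887)". THIS FILE is that audit, kernel-checked:

* §1 `not_isKatzMeasure₂_zero_of_prop422GreenbergAnyRoot`: (i) implies, on every instance of its own curve / field
  / tower hypotheses and for EVERY genuine period datum (`Ω ≠ 0`, `δ² = ±D_K`, `Ω_p`), that the ZERO series is NOT a
  Katz–de Shalit branch — because over `LK = 0` the zero series is a Greenberg frame
  (`isGreenbergLFunctionAnyRoot₂_zero_zero`) and `minus 0` has no unit coefficient. So the guard `Ω ≠ 0` moved the
  degenerate member from "refutes the fact" (v1) to "is excluded by the fact" (v2): (i) COMMITS to the non-vanishing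
  of Katz's measure over the (cyclotomic, anticyclotomic) tower — true in print (de Shalit II.4.14), not provable
  in the tree (no Hecke character with `p`-adic avatar is constructible), exactly the status of K1′'s commitment
  `SignedBaseChangeK1ZeroFrame.not_isKatzMeasure₂_zero_of_split`.
* §2 `not_isKatzMeasure₂_zero_of_package`: (ii) implies THE SAME, over every tower of its setting whose cyclotomic
  generator `γ₁` is canonical (clause c23), granted modularity (a newform for the minimal model of `E^{(D_K)}`):
  at `(LK, G) = (0, 0)` the identity (P1) `(ξ_∘ · 0) = Char(X_Gr)^{ur} · (𝓛^∘)` forces `𝓛^∘ = 0` (`Char ≠ ⊥` in a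
  domain), and then the cyclotomic-line clause (P3) `plus 𝓛^∘ = u · J(L^ε(f) · L^ε(f₂))` contradicts the
  UNCONDITIONAL existence of non-zero Kobayashi/Pollack functions (`Kobayashi2003.exists_ne_zero_and_isSignedPAdicLFunction`,
  Pollack 2003 discharged in the tree). Without c23 the line clauses are unreachable
  (`SignedBaseChangeCanonicalGeneratorPair.exists_isCyclotomicVariable_matching_iff_canonical`) and (P1) alone is
  satisfied by `ξ_∘ = 𝓛^∘ = 0` — so (ii) restricted to a non-canonical tower does NOT exclude the zero frame: c23 is
  where the binder's content sits.
* §3 `not_isKatzMeasure₂_zero_of_inputs`: in K2R⁗'s own setting (X7 pair, `p ≥ 5`, `Surj`, the package's field and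
  tower clauses) either input alone excludes the zero Katz frame; recorded from (i) with the side conditions
  discharged as in `SignedBaseChangeK2RMuZero.stub_muZero_of_prop422GreenbergAnyRoot`.

VERDICT OF THE AUDIT (numbers): 0 junk frame survives the guards in-tree; 0 non-vacuity WITNESS is constructible
in-tree (a witness = a Katz frame with `Ω ≠ 0`, supplied only by the `∃`-binder GSF); both inputs are consistent
with each other and with GSF in the only testable way (all three assert/require the same non-vanishing). The other
candidate degeneracies were checked by reading the frames' value formulas and do not vanish identically on the typed
range: `(2π/δ)^j` (`δ ≠ 0`), `(1 − ε(𝔭)⁻¹p⁻¹)`, `Γ(m)`, `(1 − ε(𝔭̄))` (`|ε(𝔭̄)| = p^{(j−m)/2} ≠ 1`),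
`typeTwoDenominator` (`ξ(𝔭̄)/ξ(𝔭)` is not a root of unity for `𝔭 ≠ 𝔭̄`), `cmPeterssonNormSq`. Nothing here asserts
anything about any curve; pure logic over the tree's definitions plus Pollack's existence theorem.
-/

set_option autoImplicit false

noncomputable section

open scoped Classical

namespace Summit.BirchSwinnertonDyer.BirchSwinnertonDyer.Theorems.SignedBaseChangeK2RBinderNonVacuity

open NumberField IsDedekindDomain Field CongruenceSubgroup WeierstrassCurve
open Literature.NumberTheory.GaloisRepresentations Literature.NumberTheory.EllipticCurves
open Literature.NumberTheory.EllipticCurves.ModularForms Literature.NumberTheory.EllipticCurves.Rank1Residual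
open Literature.NumberTheory.EllipticCurves.BurungaleCastellaSkinner2025
open Literature.NumberTheory.EllipticCurves.BurungaleSkinnerTianWan2024
open Literature.NumberTheory.EllipticCurves.GreenbergVatsal2000 Literature.NumberTheory.EllipticCurves.UnrSeries₂
open Summit.BirchSwinnertonDyer.BirchSwinnertonDyer.Theorems

variable {p : ℕ} [Fact p.Prime]

/-! ## §1. Input (i): the guarded `μ = 0` fact excludes the zero Katz frame -/

/-- **BCS25 Prop. 4.2.2 (`L_p^Gr` half, guarded v2) commits to «Katz's measure is non-zero».** Granted
`prop422_greenbergAnyRoot_hasUnitContent_minus`, on every instance of its hypotheses (globally minimal `W/ℚ` with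
newform `f` of level `N = N_E`, good reduction at `p > 2`, `K` imaginary quadratic with (Heeg), (spl), (disc),
`(N, D_K) = 1`, (irr_K), the primes `v, v̄` with `v` induced by `ι`, the cyclotomic/anticyclotomic tower with an
adapted generator pair) and for EVERY genuine period datum `Ω ≠ 0`, `δ² = ±D_K`, `Ω_p ∈ R₀ˣ`, the zero series is not
a two-variable Katz–de Shalit branch. Proof: over `LK = 0` the zero series is a Greenberg frame
(`isGreenbergLFunctionAnyRoot₂_zero_zero`), and `minus 0` has no unit coefficient (`not_hasUnitContent_minus_zero`).
[cite: BurungaleCastellaSkinner2025, Prop. 4.2.2 (§4.2, p. 9 of arXiv:2405.00270v2) (the fact whose content is unfolded)]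
[cite: deShalit1987, II.4.14 (36) and II.4.16 (49)–(50) (the measure interpolates non-zero L-values; Ω ∈ ℂˣ)] -/
theorem not_isKatzMeasure₂_zero_of_prop422GreenbergAnyRoot (h : prop422_greenbergAnyRoot_hasUnitContent_minus)
    (ι : PadicAlgCl p ≃+* ℂ) (W : WeierstrassCurve ℚ) [W.IsElliptic] [W.IsGloballyMinimal] (K : Type)
    [Field K] [NumberField K] (v vbar : HeightOneSpectrum (𝓞 K)) (κ₁ κ₂ : ZpExtension K p)
    (γ₁ γ₂ : absoluteGaloisGroup K) [Fact (ZpExtension.IsTopGeneratorPair κ₁ κ₂ γ₁ γ₂)]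
    {N : ℕ} [NeZero N] {f : CuspForm (Gamma0 N) 2} (hf : IsNewformOf W f)
    [NeZero (NumberField.discr K).natAbs]
    (hN : (N : ℤ) = W.conductorNorm ℤ) (hp : 2 < p) (hgood : W.HasGoodReductionAtPrime p)
    (hK : IsImaginaryQuadratic K) (hHeeg : SatisfiesHeegnerHypothesis N K)
    (hspl : ((Ideal.span {(p : ℤ)}).primesOver (𝓞 K)).ncard = 2)
    (hodd : Odd (NumberField.discr K)) (hne3 : NumberField.discr K ≠ -3)
    (hcop : IsCoprime (N : ℤ) (NumberField.discr K))
    (hirrK : (W.baseChange K).HasIrreducibleModPGaloisRep p)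
    (hv : ((p : ℕ) : 𝓞 K) ∈ v.asIdeal) (hvbar : ((p : ℕ) : 𝓞 K) ∈ vbar.asIdeal) (hne : vbar ≠ v)
    (hcompat : ∀ (w : InfinitePlace K) (k : 𝓞 K), k ∈ v.asIdeal ↔ ‖ι.symm (w.embedding (k : K))‖ < 1)
    (hcyc : κ₁.IsCyclotomic) (hanti : κ₂.IsAnticyclotomic)
    {Ω δ : ℂ} (Ωp : (unrIntegers p)ˣ) (hΩ : Ω ≠ 0)
    (hδ : δ ^ 2 = (NumberField.discr K : ℂ) ∨ δ ^ 2 = -(NumberField.discr K : ℂ)) :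
    ¬ IsKatzMeasure₂ ι v vbar ∅ κ₁ κ₂ γ₁⁻¹ γ₂⁻¹ 1 Ω δ ((Ωp : unrIntegers p) : ℂ_[p]) 0 :=
  fun hLK ↦ not_hasUnitContent_minus_zero
    (h ι W K v vbar κ₁ κ₂ γ₁ γ₂ hf hN hp hgood hK hHeeg hspl hodd hne3 hcop hirrK hv hvbar hne hcompat hcyc hanti
      Ω δ Ωp 0 0 hΩ hδ hLK (isGreenbergLFunctionAnyRoot₂_zero_zero ι v vbar κ₁ κ₂ γ₁⁻¹ γ₂⁻¹ f _ _))

/-! ## §2. Input (ii): the PREPRINT package binder excludes the zero Katz frame over every CANONICAL tower -/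

/-- A prime not dividing the conductor (as an integer divisibility) is a prime of good reduction.
[cite: Silverman1994, IV.10.2(a)] -/
theorem hasGoodReductionAtPrime_of_not_int_dvd_conductorNorm (W : WeierstrassCurve ℚ) [W.IsElliptic]
    (h : ¬ (p : ℤ) ∣ W.conductorNorm ℤ) : W.HasGoodReductionAtPrime p :=
  hasGoodReductionAtPrime_of_not_dvd_conductorNorm W fun hd ↦ h (by exact_mod_cast hd)

/-- **A minimal model of the `D_K`-twist of a good supersingular curve is good supersingular at `p`** when `p`
splits in the quadratic field `K` (so `p ∤ D_K`; `D_K` is square-free or `4m` with `m` square-free, and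
`E^{(4m)} ≅ E^{(m)}`): `a_p(E^{(D_K)}) = (·/p)·a_p(E) = 0`. (The `Surj`-free part of
`SignedBaseChangeAuxiliaryCurves.goodSS_surj_of_smul_eq_quadraticTwist_discr`.)
[cite: Knapp1993, Prop. 12.10] [cite: SilvermanAEC2009, VII.5 Prop. 5.1(a)] [cite: NeukirchANT1999, Ch. III Cor. (2.12)] -/
theorem goodSS_of_smul_eq_quadraticTwist_discr {K : Type} [Field K] [NumberField K]
    (h2 : Module.finrank ℚ K = 2) (V V' : WeierstrassCurve ℚ) [V.IsElliptic] [V.IsGloballyMinimal]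
    [V'.IsGloballyMinimal] (hp2 : p ≠ 2) (hpD : ¬ (p : ℤ) ∣ NumberField.discr K)
    {C : VariableChange ℚ} (hC : C • V' = V.quadraticTwist (NumberField.discr K : ℚ))
    (hgood : V.HasGoodReductionAtPrime p) (hap : V.frobeniusTrace p = 0) :
    V'.HasGoodReductionAtPrime p ∧ V'.frobeniusTrace p = 0 := by
  have hpP : p.Prime := Fact.out
  -- the square-free case, for a twisting parameter `d` with `p ∤ d`
  have key : ∀ {d : ℤ}, Squarefree d → ¬ (p : ℤ) ∣ d → ∀ {C' : VariableChange ℚ},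
      C' • V' = V.quadraticTwist (d : ℚ) → V'.HasGoodReductionAtPrime p ∧ V'.frobeniusTrace p = 0 := by
    intro d hd hpd C' hC'
    have hp2d : ¬ (p : ℤ) ∣ 2 * d := by
      intro h
      rcases (Nat.prime_iff_prime_int.mp hpP).dvd_or_dvd h with h2' | hd'
      · have : p ∣ 2 := by exact_mod_cast h2'
        exact hp2 ((Nat.prime_dvd_prime_iff_eq hpP Nat.prime_two).mp this)
      · exact hpd hd'
    refine ⟨Summit.BirchSwinnertonDyer.Rank1Residual.Supersingular.hasGoodReductionAtPrime_of_smul_eq_quadraticTwist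
        V V' p hC' hp2d hgood, ?_⟩
    rw [Summit.BirchSwinnertonDyer.Rank1Residual.Supersingular.frobeniusTrace_of_smul_eq_quadraticTwist V V' p hd
      hC' hp2d hgood, hap, mul_zero]
  rcases Literature.NumberTheory.QuadraticFields.Quadratic.isFundamentalDiscriminant_discr h2 with
    ⟨-, hsq, -⟩ | ⟨h4, -, hsq⟩
  · exact key hsq hpD hC
  · set m : ℤ := NumberField.discr K / 4 with hm
    have hdm : NumberField.discr K = m * 2 ^ 2 := by
      rw [hm]; have := Int.ediv_mul_cancel h4; omega
    obtain ⟨C₂, hC₂⟩ := V.exists_variableChange_quadraticTwist_mul_sq (m : ℚ) 2 two_ne_zero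
    have hcast : ((NumberField.discr K : ℤ) : ℚ) = (m : ℚ) * 2 ^ 2 := by rw [hdm]; push_cast; ring
    have hC' : (C₂⁻¹ * C) • V' = V.quadraticTwist (m : ℚ) := by
      rw [mul_smul, hC, hcast, ← hC₂, inv_smul_smul]
    have hpm : ¬ (p : ℤ) ∣ m := fun h ↦ hpD (hdm ▸ dvd_mul_of_dvd_left h _)
    exact key hsq hpm hC'

/-- **The BSTW two-variable signed package binder (PREPRINT) commits to «Katz's measure is non-zero» over every
CANONICAL tower.** Granted `props118_27_519_exists_signedTwoVariablePackage_supersingular_PRE` and modularity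
(`nonempty_modularParametrizationData`, for the newform of a minimal model of `E^{(D_K)}`), on every instance of the
binder's hypotheses (`E = W/ℚ` globally minimal with newform `f` of level `N_E`; `p` odd, `p ∤ N_E`, `a_p = 0`;
`K` imaginary quadratic, `p = v v̄` split with `v` induced by `ι`, `(N, D_K) = 1`, (irr_K); the cyclotomic /
anticyclotomic tower with an adapted generator pair) whose cyclotomic generator `γ₁` is CANONICAL
(`χ_cyc,K(γ₁)·ζ = cyclotomicGenerator p`, clause c23), and for EVERY genuine period datum `Ω ≠ 0`, `δ² = ±D_K`,
`Ω_p`, the zero series is not a Katz–de Shalit branch. Proof: if it were, `G = 0` is a Greenberg frame of `f` over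
it; the binder's (P1) at `(0, 0)` reads `⊥ = Char(X_Gr)^{ur}·(𝓛^∘)` with `Char(X_Gr)^{ur} ≠ ⊥`
(`SignedBaseChangeK2RTransferDescent.map_charIdealXGr₂_ne_bot`, structure map `J : ℤ_p → 𝒪_{ℂ_p}`,
`exists_structureMap_padicInt`), so `𝓛^∘ = 0`; on the canonical cyclotomic line
(`CyclotomicZp.exists_isTopGenerator_zpExtension`, matching `γ₁` by c23) the clause (P3) gives
`0 = plus 𝓛^∘ = u · J(L^ε(f) · L^ε(f₂))` with `u` a unit, contradicting the non-vanishing of Kobayashi's `L^ε`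
(`Kobayashi2003.exists_ne_zero_and_isSignedPAdicLFunction`, unconditional) and the injectivity of `J`.
[cite: BurungaleSkinnerTianWan2024, Props. 1.18, 2.7, 5.19 (arXiv:2409.01350v2, PREPRINT; the binder whose content is unfolded)]
[cite: Pollack2003, Thm. 5.6 and Cor. 5.11 (existence and non-vanishing of L_p^±)]
[cite: deShalit1987, II.4.14 (36), II.4.16 (49)–(50) (the measure is non-zero; Ω ∈ ℂˣ)] -/
theorem not_isKatzMeasure₂_zero_of_package
    (hP : props118_27_519_exists_signedTwoVariablePackage_supersingular_PRE)
    (hmod : nonempty_modularParametrizationData)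
    (ι : PadicAlgCl p ≃+* ℂ) (W : WeierstrassCurve ℚ) [W.IsElliptic] [W.IsGloballyMinimal] (K : Type)
    [Field K] [NumberField K] (v vbar : HeightOneSpectrum (𝓞 K)) (κ₁ κ₂ : ZpExtension K p)
    (γ₁ γ₂ : absoluteGaloisGroup K) [Fact (ZpExtension.IsTopGeneratorPair κ₁ κ₂ γ₁ γ₂)]
    {N : ℕ} [NeZero N] (f : CuspForm (Gamma0 N) 2) [NeZero (NumberField.discr K).natAbs]
    (hf : IsNewformOf W f) (hN : (N : ℤ) = W.conductorNorm ℤ) (hp : p ≠ 2)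
    (hpN : ¬ (p : ℤ) ∣ W.conductorNorm ℤ) (hap : W.frobeniusTrace p = 0)
    (hK : IsImaginaryQuadratic K) (hsplit : ((Ideal.span {(p : ℤ)}).primesOver (𝓞 K)).ncard = 2)
    (hv : ((p : ℕ) : 𝓞 K) ∈ v.asIdeal) (hvbar : ((p : ℕ) : 𝓞 K) ∈ vbar.asIdeal) (hne : vbar ≠ v)
    (hι : ∀ (w : InfinitePlace K) (k : 𝓞 K), k ∈ v.asIdeal ↔ ‖ι.symm (w.embedding (k : K))‖ < 1)
    (hcop : IsCoprime (N : ℤ) (NumberField.discr K))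
    (hirr : ∀ ρ : ModPGaloisRep K (ZMod p) 2, (W.baseChange K).IsTorsionGaloisRep p ρ →
      FramedRep.IsAbsolutelyIrreducible ρ)
    (hcyc : κ₁.IsCyclotomic) (hanti : κ₂.IsAnticyclotomic)
    (hcan : ∃ ζ : ℤ_[p]ˣ, IsOfFinOrder ζ ∧
      ((GaloisRep.cyclotomicCharacter K p γ₁ * ζ : ℤ_[p]ˣ) : ℤ_[p]) = (cyclotomicGenerator p : ℤ_[p]))
    {Ω δ : ℂ} (Ωp : (unrIntegers p)ˣ) (hΩ : Ω ≠ 0)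
    (hδ : δ ^ 2 = (NumberField.discr K : ℂ) ∨ δ ^ 2 = -(NumberField.discr K : ℂ)) :
    ¬ IsKatzMeasure₂ ι v vbar ∅ κ₁ κ₂ γ₁⁻¹ γ₂⁻¹ 1 Ω δ ((Ωp : unrIntegers p) : ℂ_[p]) 0 := by
  intro hLK
  have hpP : p.Prime := Fact.out
  -- the zero Greenberg frame over the zero Katz series, and a structure map `J`
  have hG0 := isGreenbergLFunctionAnyRoot₂_zero_zero ι v vbar κ₁ κ₂ γ₁⁻¹ γ₂⁻¹ f (NumberField.discr K).natAbs
    (NumberField.classNumber K)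
  obtain ⟨J, hJ⟩ := exists_structureMap_padicInt (p := p)
  have hJinj : Function.Injective J := structureMap_injective hJ
  -- the binder at `(LK, G) = (0, 0)`, sign `ε = 1`
  obtain ⟨xi, Lsig, hP1, hline⟩ := hP ι W K v vbar κ₁ κ₂ γ₁ γ₂ f hf hN hp hpN hap hK hsplit hv hvbar hne hι
    hcop hirr hcyc hanti Ω δ Ωp 0 0 hΩ hδ hLK hG0 J hJ 1
  -- (P1) at `G = 0`: `𝓛^∘ = 0`
  have hLsig : Lsig = 0 := by
    by_contra h0
    exact SignedBaseChangeK2RTransferDescent.ne_zero_of_span_mul_eq hP1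
      (SignedBaseChangeK2RTransferDescent.map_charIdealXGr₂_ne_bot _ κ₁ κ₂ vbar γ₁ γ₂ hJinj) h0 rfl
  -- the canonical cyclotomic line over `ℚ`, matching `γ₁` by c23
  obtain ⟨γ, hγ, hχ⟩ := CyclotomicZp.exists_isTopGenerator_zpExtension p
  have hγc : IsCyclotomicVariable p γ := ⟨1, IsOfFinOrder.one, by rw [mul_one]; exact hχ⟩
  have hmatch := SignedBaseChangeK2RTransferDescent.exists_isOfFinOrder_mul_eq_of_canonical hcan hγc
  -- a minimal model `W₂` of `E^{(D_K)}`, good supersingular at `p`, and its newform (modularity)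
  have hD0 : (NumberField.discr K : ℚ) ≠ 0 := by exact_mod_cast NumberField.discr_ne_zero K
  obtain ⟨W₂, _, _, C₂, hC₂⟩ := exists_isGloballyMinimal_smul_eq_quadraticTwist W hD0
  have hgood : W.HasGoodReductionAtPrime p := hasGoodReductionAtPrime_of_not_int_dvd_conductorNorm W hpN
  have hpD : ¬ (p : ℤ) ∣ NumberField.discr K :=
    Literature.NumberTheory.EllipticCurves.not_dvd_discr_of_ncard_primesOver_eq_two hK.1 hpP hsplit
  obtain ⟨hgood₂, hap₂⟩ := goodSS_of_smul_eq_quadraticTwist_discr hK.1 W W₂ hp hpD hC₂ hgood hap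
  haveI : NeZero (W₂.conductorNorm ℤ) := ⟨(W₂.conductorNorm_pos_holds).ne'⟩
  obtain ⟨Dm₂⟩ := hmod W₂
  -- non-zero Kobayashi functions of sign `1` for `f` and `f₂` (Pollack, unconditional)
  obtain ⟨L₁, hL₁0, hL₁⟩ := Kobayashi2003.exists_ne_zero_and_isSignedPAdicLFunction hp hf hgood hap 1
  obtain ⟨L₂, hL₂0, hL₂⟩ :=
    Kobayashi2003.exists_ne_zero_and_isSignedPAdicLFunction hp Dm₂.isNewformOf hgood₂ hap₂ 1
  -- (P3) on the line: `plus 𝓛^∘ = u · J(L₁ L₂)` with `𝓛^∘ = 0`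
  obtain ⟨-, hP3⟩ := hline (CyclotomicZp.zpExtension p) γ (CyclotomicZp.isCyclotomic_zpExtension p) hγ hγc
    hmatch W₂ C₂ hC₂
  obtain ⟨u, hu, h3⟩ := hP3 Dm₂.f Dm₂.isNewformOf L₁ L₂ hL₁ hL₂
  rw [hLsig] at h3
  have hzero : PowerSeries.map J (L₁ * L₂) = 0 := by
    have h' : u * PowerSeries.map J (L₁ * L₂) = 0 := by rw [← h3]; simp [UnrSeries₂.plus]
    exact (hu.mul_right_eq_zero).mp h'
  exact map_structureMap_ne_zero hJ (mul_ne_zero hL₁0 hL₂0) hzero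

/-! ## §3. K2R⁗'s own setting: either input excludes the zero Katz frame over the package's tower -/

/-- **In the setting of K2R⁗** (an X7 pair `(W, p)` with `p ≥ 5` and `ρ̄` onto, and the field/tower clauses of the
twist-pair package: `K` imaginary quadratic, `p = v v̄` split, `(N, D_K) = 1`, every `ℓ ∣ N` split (Heeg), `2`
split), input (i) excludes the zero Katz frame for every genuine period datum — the side conditions of BCS25
Prop. 4.2.2 are discharged exactly as in `SignedBaseChangeK2RMuZero.stub_muZero_of_prop422GreenbergAnyRoot`
((disc) from «2 splits», (irr_K) from `Surj`, good reduction and `a_p = 0` from X7 at `p ≥ 5`).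
[cite: BurungaleCastellaSkinner2025, Prop. 4.2.2 (§4.2, p. 9 of arXiv:2405.00270v2)]
[cite: deShalit1987, II.4.14 (36) (the measure is non-zero)] -/
theorem not_isKatzMeasure₂_zero_of_inputs (h : prop422_greenbergAnyRoot_hasUnitContent_minus)
    (W : WeierstrassCurve ℚ) [W.IsElliptic] [W.IsGloballyMinimal] (hp5 : 5 ≤ p) (hX : ClassX7 W p)
    (hs : Surj W p) (K : Type) [Field K] [NumberField K] (ι : PadicAlgCl p ≃+* ℂ)
    (v vbar : HeightOneSpectrum (𝓞 K)) (κ₁ κ₂ : ZpExtension K p) (γ₁ γ₂ : absoluteGaloisGroup K)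
    [Fact (ZpExtension.IsTopGeneratorPair κ₁ κ₂ γ₁ γ₂)] [NeZero (NumberField.discr K).natAbs]
    {N : ℕ} [NeZero N] {f : CuspForm (Gamma0 N) 2} (hf : IsNewformOf W f) (hN : (N : ℤ) = W.conductorNorm ℤ)
    (hK : IsImaginaryQuadratic K) (hsplit : ((Ideal.span {(p : ℤ)}).primesOver (𝓞 K)).ncard = 2)
    (hv : ((p : ℕ) : 𝓞 K) ∈ v.asIdeal) (hvbar : ((p : ℕ) : 𝓞 K) ∈ vbar.asIdeal) (hne : vbar ≠ v)
    (hι : ∀ (w : InfinitePlace K) (k : 𝓞 K), k ∈ v.asIdeal ↔ ‖ι.symm (w.embedding (k : K))‖ < 1)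
    (hcop : IsCoprime (N : ℤ) (NumberField.discr K))
    (hHeeg : ∀ ℓ : ℕ, ℓ.Prime → ℓ ∣ N → ((Ideal.span {(ℓ : ℤ)}).primesOver (𝓞 K)).ncard = 2)
    (h2 : ((Ideal.span {(2 : ℤ)}).primesOver (𝓞 K)).ncard = 2)
    (hcyc : κ₁.IsCyclotomic) (hanti : κ₂.IsAnticyclotomic)
    {Ω δ : ℂ} (Ωp : (unrIntegers p)ˣ) (hΩ : Ω ≠ 0)
    (hδ : δ ^ 2 = (NumberField.discr K : ℂ) ∨ δ ^ 2 = -(NumberField.discr K : ℂ)) :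
    ¬ IsKatzMeasure₂ ι v vbar ∅ κ₁ κ₂ γ₁⁻¹ γ₂⁻¹ 1 Ω δ ((Ωp : unrIntegers p) : ℂ_[p]) 0 := by
  have hp : 2 < p := by omega
  have hgood : W.HasGoodReductionAtPrime p := hX.1.1
  have hirr : (W.baseChange K).HasIrreducibleModPGaloisRep p :=
    Summit.BirchSwinnertonDyer.Rank1Residual.irrK_of_surj W p hs K hK.1
  obtain ⟨hodd, hne3⟩ := SignedBaseChangeK2RMuZero.odd_discr_and_discr_ne_neg_three_of_two_split K hK.1 h2
  exact not_isKatzMeasure₂_zero_of_prop422GreenbergAnyRoot h ι W K v vbar κ₁ κ₂ γ₁ γ₂ hf hN hp hgood hK hHeeg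
    hsplit hodd hne3 hcop hirr hv hvbar hne hι hcyc hanti Ωp hΩ hδ

end Summit.BirchSwinnertonDyer.BirchSwinnertonDyer.Theorems.SignedBaseChangeK2RBinderNonVacuity

end
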